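import Mathlib
import Summits.NavierStokesRegularity.NavierStokesRegularity.Theorems.WakeRatchetTailRatchetRelayFixedPoint
import Summits.NavierStokesRegularity.NavierStokesRegularity.Theorems.WakeRatchetTailRatchetRelayDilationLipschitzForcing
import Summits.NavierStokesRegularity.NavierStokesRegularity.Theorems.WakeRatchetTailRatchetRelayFrontState
import HarnessLib

/-!
# `WakeRatchet.TailRatchet` (stmt-NavierStokesRegularity-21808): the lacunary branch `s ↦ δ_s` is
# LIPSCHITZ in the time ratio away from `s = 2`

Support file for the crux `TailRatchet` (route `WakeRatchet`; MODEL lattice ODEs of Tao 2016 §1.2, §4 —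
nothing in this file is a statement about the Navier–Stokes equations, and no item is closed here).

Context (census of stmt-21808, programme R-lac → continuation): at every `s ∈ [2 − 10⁻²⁶, 2]` the front
problem has exactly one solution `(h_s, δ_s)` in the weighted ball (`…RelayFront`, `…RelayFrontUnique`).  Here
the drain parameters of two such fronts are compared:

* (`…RelayFrontState.front_state` — a front, extended continuously to `ℝ`, is a fixed point of the Picard map;)
* `branch_step` — one improvement of a common bound `μ` on the weighted distances of two fronts at `s₁`, `s₂`
  to `κμ + L`, `κ` the contraction constant at `s₁`, `L` the distance between `T_{s₁}x₂` and `x₂ = T_{s₂}x₂`;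
* `branch_lipschitz` — for `s₁, s₂ ∈ [2 − 10⁻²⁶, σ]`, `σ < 2`: `|δ₁ − δ₂| ≤ 2200000·(1334 + 64/(2−σ))·|s₁ − s₂|`
  (and the same bound for `|h₁ − h₂|e^{-t/2}`), via `…RelayDilationLipschitzForcing.forcing_lipschitz_s`.

With `|δ_s| ≤ 8K(2−s)` (continuity at `s = 2`) this makes `s ↦ δ_s` continuous on `[2 − 10⁻²⁶, 2]` — the input
of the intermediate-value argument of `…LacunaryFrontAll`.

HONEST FRAMING: MODEL lattice only; lacunary fronts (LARGE `ε₀`) do NOT refute `TailRatchet` (which needs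
`Λ → 1`); the construction item and the crux stay open.
-/

noncomputable section

set_option linter.dupNamespace false

namespace Summit.NavierStokesRegularity.NavierStokesRegularity.Theorems

namespace WakeRatchetRelayBranch

open Set Filter Topology MeasureTheory
open WakeRatchetRelayNonlinearMap WakeRatchetRelayInverseBound WakeRatchetRelayContraction
  WakeRatchetRelayFixedPoint WakeRatchetRelayDilationLipschitz WakeRatchetRelayFrontUnique
  WakeRatchetRelayFrontState

/-! ## One improvement step -/

/-- **One improvement step.**  Two fixed points `x₁ = (g₁, F₁, δ₁)` of `T_{s₁}` and `x₂ = (g₂, F₂, δ₂)` of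
`T_{s₂}` in the ball of radius `rc`, the comparison state `y = (g_y, ε_y) = T_{s₁}x₂` at weighted distance
`≤ L` from `x₂`, and a common bound `μ` on the three weighted distances of `x₁, x₂` give the improved bound
`K(22|s₁−2| + 36rc + 32rc²)·μ + L`. [folklore] -/
theorem branch_step {s₁ rc μ L : ℝ} (hs1 : 3 / 2 ≤ s₁) (hs2 : s₁ ≤ 2)
    {g₁ g₂ gy F₁ F₂ : ℝ → ℝ} {δ₁ δ₂ εy B₁ By : ℝ}
    (hgc₁ : Continuous g₁) (hgc₂ : Continuous g₂) (hgyc : Continuous gy)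
    (hgd₁ : ∀ t : ℝ, t < 0 → HasDerivAt g₁ (F₁ t) t) (hgd₂ : ∀ t : ℝ, t < 0 → HasDerivAt g₂ (F₂ t) t)
    (hF₁ : ∀ t : ℝ, F₁ t = 2 * Real.exp (t / 2) * g₁ (t / 2) +
      (((-(Real.exp t - 4 / s₁ ^ 2 * Real.exp (2 * t / s₁)) -
          (2 * Real.exp (t / 2) * g₁ (t / 2) - 8 / s₁ ^ 2 * Real.exp (t / s₁) * g₁ (t / s₁)) +
          4 / s₁ ^ 2 * g₁ (t / s₁) ^ 2 -
          δ₁ * (4 * s₁ * ((Real.exp t + g₁ t) * (Real.exp (s₁ * t) + g₁ (s₁ * t))) - 8 * Real.exp (3 * t))))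
        - δ₁ * (8 * Real.exp (3 * t))))
    (hgρ₁ : ∀ t : ℝ, t ≤ 0 → |g₁ t| ≤ rc * Real.exp (t / 2))
    (hgρ₂ : ∀ t : ℝ, t ≤ 0 → |g₂ t| ≤ rc * Real.exp (t / 2)) (hδ₁ : |δ₁| ≤ rc)
    (hg0₁ : g₁ 0 = 0) (hgy0 : gy 0 = 0) (hgl₁ : Tendsto g₁ atBot (𝓝 0)) (hgyl : Tendsto gy atBot (𝓝 0))
    (hgB₁ : ∀ t : ℝ, t ≤ 0 → |g₁ t| ≤ B₁) (hgyB : ∀ t : ℝ, t ≤ 0 → |gy t| ≤ By)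
    (hgyd : ∀ t : ℝ, t < 0 → HasDerivAt gy
        (2 * Real.exp (t / 2) * gy (t / 2) +
          (((-(Real.exp t - 4 / s₁ ^ 2 * Real.exp (2 * t / s₁)) -
              (2 * Real.exp (t / 2) * g₂ (t / 2) - 8 / s₁ ^ 2 * Real.exp (t / s₁) * g₂ (t / s₁)) +
              4 / s₁ ^ 2 * g₂ (t / s₁) ^ 2 -
              δ₂ * (4 * s₁ * ((Real.exp t + g₂ t) * (Real.exp (s₁ * t) + g₂ (s₁ * t))) - 8 * Real.exp (3 * t))))
            - εy * (8 * Real.exp (3 * t)))) t)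
    (hLδ : |εy - δ₂| ≤ L) (hLg : ∀ t : ℝ, t ≤ 0 → |gy t - g₂ t| ≤ L * Real.exp (t / 2))
    (hLF : ∀ t : ℝ, t < 0 → |(2 * Real.exp (t / 2) * gy (t / 2) +
          (((-(Real.exp t - 4 / s₁ ^ 2 * Real.exp (2 * t / s₁)) -
              (2 * Real.exp (t / 2) * g₂ (t / 2) - 8 / s₁ ^ 2 * Real.exp (t / s₁) * g₂ (t / s₁)) +
              4 / s₁ ^ 2 * g₂ (t / s₁) ^ 2 -
              δ₂ * (4 * s₁ * ((Real.exp t + g₂ t) * (Real.exp (s₁ * t) + g₂ (s₁ * t))) - 8 * Real.exp (3 * t))))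
            - εy * (8 * Real.exp (3 * t)))) - F₂ t| ≤ L * Real.exp (t / 2))
    (hμg : ∀ t : ℝ, t ≤ 0 → |g₁ t - g₂ t| ≤ μ * Real.exp (t / 2))
    (hμF : ∀ t : ℝ, t < 0 → |F₁ t - F₂ t| ≤ μ * Real.exp (t / 2)) (hμδ : |δ₁ - δ₂| ≤ μ) :
    (∀ t : ℝ, t ≤ 0 → |g₁ t - g₂ t| ≤
        (1100000 * (22 * |s₁ - 2| + 36 * rc + 32 * rc ^ 2) * μ + L) * Real.exp (t / 2)) ∧
      (∀ t : ℝ, t < 0 → |F₁ t - F₂ t| ≤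
        (1100000 * (22 * |s₁ - 2| + 36 * rc + 32 * rc ^ 2) * μ + L) * Real.exp (t / 2)) ∧
      |δ₁ - δ₂| ≤ 1100000 * (22 * |s₁ - 2| + 36 * rc + 32 * rc ^ 2) * μ + L := by
  -- the fixed-point law of `x₁` in explicit form
  have hgd₁e : ∀ t : ℝ, t < 0 → HasDerivAt g₁
      (2 * Real.exp (t / 2) * g₁ (t / 2) +
        (((-(Real.exp t - 4 / s₁ ^ 2 * Real.exp (2 * t / s₁)) -
            (2 * Real.exp (t / 2) * g₁ (t / 2) - 8 / s₁ ^ 2 * Real.exp (t / s₁) * g₁ (t / s₁)) +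
            4 / s₁ ^ 2 * g₁ (t / s₁) ^ 2 -
            δ₁ * (4 * s₁ * ((Real.exp t + g₁ t) * (Real.exp (s₁ * t) + g₁ (s₁ * t))) - 8 * Real.exp (3 * t))))
          - δ₁ * (8 * Real.exp (3 * t)))) t := fun t ht => by rw [← hF₁ t]; exact hgd₁ t ht
  obtain ⟨hC1, hC2, hC3⟩ := picard_contract (μ := μ) hs1 hs2 hgc₁ hgc₂ hgd₁ hgd₂ hgρ₁ hgρ₂ hδ₁
    hgc₁ hgyc hg0₁ hgy0 hgl₁ hgyl hgB₁ hgyB hgd₁e hgyd hμg hμF hμδ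
  set κμ : ℝ := 1100000 * (22 * |s₁ - 2| + 36 * rc + 32 * rc ^ 2) * μ with hκμ
  refine ⟨fun t ht => ?_, fun t ht => ?_, ?_⟩
  · calc |g₁ t - g₂ t| ≤ |g₁ t - gy t| + |gy t - g₂ t| := abs_sub_le _ _ _
      _ ≤ κμ * Real.exp (t / 2) + L * Real.exp (t / 2) := add_le_add (hC2 t ht) (hLg t ht)
      _ = (κμ + L) * Real.exp (t / 2) := by ring
  · have h3 := hC3 t ht.le
    rw [← hF₁ t] at h3
    calc |F₁ t - F₂ t| ≤ |F₁ t - (2 * Real.exp (t / 2) * gy (t / 2) +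
          (((-(Real.exp t - 4 / s₁ ^ 2 * Real.exp (2 * t / s₁)) -
              (2 * Real.exp (t / 2) * g₂ (t / 2) - 8 / s₁ ^ 2 * Real.exp (t / s₁) * g₂ (t / s₁)) +
              4 / s₁ ^ 2 * g₂ (t / s₁) ^ 2 -
              δ₂ * (4 * s₁ * ((Real.exp t + g₂ t) * (Real.exp (s₁ * t) + g₂ (s₁ * t))) - 8 * Real.exp (3 * t))))
            - εy * (8 * Real.exp (3 * t))))| +
          |(2 * Real.exp (t / 2) * gy (t / 2) +
          (((-(Real.exp t - 4 / s₁ ^ 2 * Real.exp (2 * t / s₁)) -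
              (2 * Real.exp (t / 2) * g₂ (t / 2) - 8 / s₁ ^ 2 * Real.exp (t / s₁) * g₂ (t / s₁)) +
              4 / s₁ ^ 2 * g₂ (t / s₁) ^ 2 -
              δ₂ * (4 * s₁ * ((Real.exp t + g₂ t) * (Real.exp (s₁ * t) + g₂ (s₁ * t))) - 8 * Real.exp (3 * t))))
            - εy * (8 * Real.exp (3 * t)))) - F₂ t| := abs_sub_le _ _ _
      _ ≤ κμ * Real.exp (t / 2) + L * Real.exp (t / 2) := add_le_add h3 (hLF t ht)
      _ = (κμ + L) * Real.exp (t / 2) := by ring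
  · calc |δ₁ - δ₂| ≤ |δ₁ - εy| + |εy - δ₂| := abs_sub_le _ _ _
      _ ≤ κμ + L := add_le_add hC1 hLδ

/-! ## The comparison state `y = T_{s₁}(x₂)` -/

/-- **The comparison state.**  For a front state `x₂ = (g₂, δ₂)` at time ratio `s₂` (bordered law at `s₂`,
`|g₂| ≤ 4e^{t/2}`, `|g₂'| ≤ 4e^{t/2}`, `|δ₂| ≤ 4`) and another time ratio `s₁`, both in `[3/2, σ]`, `σ < 2`, the
Picard image `y = (g_y, ε_y) = T_{s₁}x₂` exists and lies within weighted distance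
`L = 1100000·(1334 + 64/(2−σ))·|s₁−s₂|` of `x₂` (drain parameter, profile, and bordered right-hand side).
[cite: Tao2016AveragedNS, §1.2 (dyadic model); cell vocabulary (programme R-lac of the census of stmt-21808, continuation in `s`)] -/
theorem comparison_state {s₁ s₂ σ : ℝ} (hs₁3 : 3 / 2 ≤ s₁) (hσ₁ : s₁ ≤ σ) (hs₂3 : 3 / 2 ≤ s₂)
    (hσ₂ : s₂ ≤ σ) (hσ : σ < 2) {g₂ F₂ : ℝ → ℝ} {δ₂ B₂ : ℝ}
    (hgc₂ : Continuous g₂) (hg0₂ : g₂ 0 = 0) (hgl₂ : Tendsto g₂ atBot (𝓝 0))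
    (hgB₂ : ∀ t : ℝ, t ≤ 0 → |g₂ t| ≤ B₂)
    (hgd₂ : ∀ t : ℝ, t < 0 → HasDerivAt g₂ (F₂ t) t)
    (hF₂ : ∀ t : ℝ, F₂ t = 2 * Real.exp (t / 2) * g₂ (t / 2) +
      (((-(Real.exp t - 4 / s₂ ^ 2 * Real.exp (2 * t / s₂)) -
          (2 * Real.exp (t / 2) * g₂ (t / 2) - 8 / s₂ ^ 2 * Real.exp (t / s₂) * g₂ (t / s₂)) +
          4 / s₂ ^ 2 * g₂ (t / s₂) ^ 2 -
          δ₂ * (4 * s₂ * ((Real.exp t + g₂ t) * (Real.exp (s₂ * t) + g₂ (s₂ * t))) - 8 * Real.exp (3 * t))))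
        - δ₂ * (8 * Real.exp (3 * t))))
    (hg4 : ∀ t : ℝ, t ≤ 0 → |g₂ t| ≤ 4 * Real.exp (t / 2))
    (hF4 : ∀ t : ℝ, t < 0 → |F₂ t| ≤ 4 * Real.exp (t / 2)) (hδ4 : |δ₂| ≤ 4) :
    ∃ εy : ℝ, ∃ gy : ℝ → ℝ, Continuous gy ∧ gy 0 = 0 ∧ Tendsto gy atBot (𝓝 0) ∧
      (∃ By : ℝ, ∀ t : ℝ, t ≤ 0 → |gy t| ≤ By) ∧
      (∀ t : ℝ, t < 0 → HasDerivAt gy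
        (2 * Real.exp (t / 2) * gy (t / 2) +
          (((-(Real.exp t - 4 / s₁ ^ 2 * Real.exp (2 * t / s₁)) -
              (2 * Real.exp (t / 2) * g₂ (t / 2) - 8 / s₁ ^ 2 * Real.exp (t / s₁) * g₂ (t / s₁)) +
              4 / s₁ ^ 2 * g₂ (t / s₁) ^ 2 -
              δ₂ * (4 * s₁ * ((Real.exp t + g₂ t) * (Real.exp (s₁ * t) + g₂ (s₁ * t))) - 8 * Real.exp (3 * t))))
            - εy * (8 * Real.exp (3 * t)))) t) ∧
      |εy - δ₂| ≤ 1100000 * (1334 + 64 * (1 / (2 - σ))) * |s₁ - s₂| ∧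
      (∀ t : ℝ, t ≤ 0 → |gy t - g₂ t| ≤ 1100000 * (1334 + 64 * (1 / (2 - σ))) * |s₁ - s₂| * Real.exp (t / 2)) ∧
      (∀ t : ℝ, t < 0 → |(2 * Real.exp (t / 2) * gy (t / 2) +
          (((-(Real.exp t - 4 / s₁ ^ 2 * Real.exp (2 * t / s₁)) -
              (2 * Real.exp (t / 2) * g₂ (t / 2) - 8 / s₁ ^ 2 * Real.exp (t / s₁) * g₂ (t / s₁)) +
              4 / s₁ ^ 2 * g₂ (t / s₁) ^ 2 -
              δ₂ * (4 * s₁ * ((Real.exp t + g₂ t) * (Real.exp (s₁ * t) + g₂ (s₁ * t))) - 8 * Real.exp (3 * t))))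
            - εy * (8 * Real.exp (3 * t)))) - F₂ t| ≤
        1100000 * (1334 + 64 * (1 / (2 - σ))) * |s₁ - s₂| * Real.exp (t / 2)) := by
  have hσ2 : σ ≤ 2 := hσ.le
  have hs₁2 : s₁ ≤ 2 := hσ₁.trans hσ2
  have hq0 : 0 < 1 / (2 - σ) := one_div_pos.2 (by linarith)
  set C : ℝ := 1334 + 64 * (1 / (2 - σ)) with hC
  have hC0 : 0 ≤ C := by rw [hC]; positivity
  have hCeq : (6 + 16 * 4 + 4 * 4 ^ 2 + 4 * 4 ^ 2 * (1 / (2 - σ)) + 12 * 4 * (1 + 4) ^ 2 : ℝ) = C := by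
    rw [hC]; ring
  have hΔ0 : 0 ≤ |s₁ - s₂| := abs_nonneg _
  -- the Picard image at `s₁`
  obtain ⟨εy, gy, hgyc, hgy0, hgyl, hgyd, -, hgyb, -⟩ := picard_step hs₁3 hs₁2 hgc₂ hgd₂ hg4 hF4 hδ4
  have hgyB : ∀ t : ℝ, t ≤ 0 → |gy t| ≤
      1100000 * (4 * |s₁ - 2| + 22 * |s₁ - 2| * 4 + 20 * 4 ^ 2 + 16 * 4 ^ 3) := fun t ht =>
    (hgyb t ht).trans (by
      have h1 : Real.exp (t / 2) ≤ 1 := Real.exp_le_one_iff.2 (by linarith)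
      have h2 : 0 ≤ 1100000 * (4 * |s₁ - 2| + 22 * |s₁ - 2| * 4 + 20 * 4 ^ 2 + 16 * 4 ^ 3) := by positivity
      nlinarith only [h1, h2])
  -- the two forcings at `x₂`
  set N₁ : ℝ → ℝ := fun t =>
    (-(Real.exp t - 4 / s₁ ^ 2 * Real.exp (2 * t / s₁)) -
      (2 * Real.exp (t / 2) * g₂ (t / 2) - 8 / s₁ ^ 2 * Real.exp (t / s₁) * g₂ (t / s₁)) +
      4 / s₁ ^ 2 * g₂ (t / s₁) ^ 2 -
      δ₂ * (4 * s₁ * ((Real.exp t + g₂ t) * (Real.exp (s₁ * t) + g₂ (s₁ * t))) - 8 * Real.exp (3 * t))) with hN₁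
  set N₂ : ℝ → ℝ := fun t =>
    (-(Real.exp t - 4 / s₂ ^ 2 * Real.exp (2 * t / s₂)) -
      (2 * Real.exp (t / 2) * g₂ (t / 2) - 8 / s₂ ^ 2 * Real.exp (t / s₂) * g₂ (t / s₂)) +
      4 / s₂ ^ 2 * g₂ (t / s₂) ^ 2 -
      δ₂ * (4 * s₂ * ((Real.exp t + g₂ t) * (Real.exp (s₂ * t) + g₂ (s₂ * t))) - 8 * Real.exp (3 * t))) with hN₂
  have hN₁c : Continuous N₁ := by rw [hN₁]; fun_prop
  have hN₂c : Continuous N₂ := by rw [hN₂]; fun_prop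
  have hNlt : ∀ t : ℝ, t < 0 → |N₁ t - N₂ t| ≤ C * |s₁ - s₂| * Real.exp (t / 2) := by
    intro t ht
    have := forcing_lipschitz_s (r := 4) hs₁3 hσ₁ hs₂3 hσ₂ hσ hgd₂ hg4 hF4 hδ4 ht
    rw [hCeq] at this
    simpa only [hN₁, hN₂] using this
  have hNle : ∀ t : ℝ, t ≤ 0 → |N₁ t - N₂ t| ≤ C * |s₁ - s₂| * Real.exp (t / 2) :=
    weighted_bound_Iic (hN₁c.sub hN₂c) hNlt
  have hgyd' : ∀ t : ℝ, t < 0 → HasDerivAt gy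
      (2 * Real.exp (t / 2) * gy (t / 2) + (N₁ t - εy * (8 * Real.exp (3 * t)))) t := fun t ht => by
    simpa only [hN₁] using hgyd t ht
  have hg₂d'' : ∀ t : ℝ, t < 0 → HasDerivAt g₂
      (2 * Real.exp (t / 2) * g₂ (t / 2) + (N₂ t - δ₂ * (8 * Real.exp (3 * t)))) t := fun t ht => by
    have := hgd₂ t ht
    rw [hF₂ t] at this
    simpa only [hN₂] using this
  obtain ⟨hDε, hDg, hDg'⟩ := drain_bordered_difference hN₁c hN₂c hNle hgyc.continuousOn hgc₂.continuousOn
    hgyd' hg₂d'' hgyB hgB₂ hgy0 hg0₂ hgyl hgl₂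
  refine ⟨εy, gy, hgyc, hgy0, hgyl, ⟨_, hgyB⟩, hgyd, ?_, fun t ht => ?_, fun t ht => ?_⟩
  · exact hDε.trans (by nlinarith only [mul_nonneg hC0 hΔ0])
  · exact (hDg t ht).trans (by nlinarith only [mul_nonneg (mul_nonneg hC0 hΔ0) (Real.exp_pos (t / 2)).le])
  · have h1 := hDg' t ht.le
    have heqF : (2 * Real.exp (t / 2) * gy (t / 2) +
          (((-(Real.exp t - 4 / s₁ ^ 2 * Real.exp (2 * t / s₁)) -
              (2 * Real.exp (t / 2) * g₂ (t / 2) - 8 / s₁ ^ 2 * Real.exp (t / s₁) * g₂ (t / s₁)) +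
              4 / s₁ ^ 2 * g₂ (t / s₁) ^ 2 -
              δ₂ * (4 * s₁ * ((Real.exp t + g₂ t) * (Real.exp (s₁ * t) + g₂ (s₁ * t))) - 8 * Real.exp (3 * t))))
            - εy * (8 * Real.exp (3 * t)))) - F₂ t =
        2 * Real.exp (t / 2) * (gy (t / 2) - g₂ (t / 2)) +
          ((N₁ t - N₂ t) - (εy - δ₂) * (8 * Real.exp (3 * t))) := by
      rw [hF₂ t]; simp only [hN₁, hN₂]; ring
    rw [heqF]
    exact h1.trans (by nlinarith only [mul_nonneg (mul_nonneg hC0 hΔ0) (Real.exp_pos (t / 2)).le])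

/-! ## The branch is Lipschitz -/

/-- **THE BRANCH IS LIPSCHITZ IN `s` AWAY FROM `2`.**  Let `2 − 10⁻²⁶ ≤ s₁, s₂ ≤ σ < 2` and let
`bᵢ = e^{t} + hᵢ` solve `b' = (4/sᵢ²)b(t/sᵢ)² − 4sᵢδᵢ·b(t)b(sᵢt)` on `t < 0` with `hᵢ` continuous on
`(−∞,0]`, `hᵢ(0) = 0`, `|hᵢ| ≤ 8800000(2−sᵢ)e^{t/2}`, `|δᵢ| ≤ 8800000(2−sᵢ)`.  Then
`|δ₁ − δ₂| ≤ 2200000·(1334 + 64/(2−σ))·|s₁ − s₂|` and `|h₁(t) − h₂(t)| ≤ 2200000·(1334 + 64/(2−σ))·|s₁−s₂|·e^{t/2}`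
on `t ≤ 0`.
[cite: Tao2016AveragedNS, §1.2 (dyadic model); cell vocabulary (scalar front equation of `DyadicScalarFronts`; programme R-lac of the census of stmt-21808, continuation in `s`)] -/
theorem branch_lipschitz {s₁ s₂ σ : ℝ} (hs₁ : 2 - 1 / 10 ^ 26 ≤ s₁) (hs₂ : 2 - 1 / 10 ^ 26 ≤ s₂)
    (hσ₁ : s₁ ≤ σ) (hσ₂ : s₂ ≤ σ) (hσ : σ < 2)
    {h₁ h₂ : ℝ → ℝ} {δ₁ δ₂ : ℝ}
    (hc₁ : ContinuousOn h₁ (Iic 0)) (hc₂ : ContinuousOn h₂ (Iic 0)) (h0₁ : h₁ 0 = 0) (h0₂ : h₂ 0 = 0)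
    (hρ₁ : ∀ t : ℝ, t ≤ 0 → |h₁ t| ≤ 8800000 * (2 - s₁) * Real.exp (t / 2))
    (hρ₂ : ∀ t : ℝ, t ≤ 0 → |h₂ t| ≤ 8800000 * (2 - s₂) * Real.exp (t / 2))
    (hδ₁ : |δ₁| ≤ 8800000 * (2 - s₁)) (hδ₂ : |δ₂| ≤ 8800000 * (2 - s₂))
    (hf₁ : ∀ t : ℝ, t < 0 → HasDerivAt (fun x => Real.exp x + h₁ x)
        (4 / s₁ ^ 2 * (Real.exp (t / s₁) + h₁ (t / s₁)) ^ 2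
          - 4 * s₁ * δ₁ * ((Real.exp t + h₁ t) * (Real.exp (s₁ * t) + h₁ (s₁ * t)))) t)
    (hf₂ : ∀ t : ℝ, t < 0 → HasDerivAt (fun x => Real.exp x + h₂ x)
        (4 / s₂ ^ 2 * (Real.exp (t / s₂) + h₂ (t / s₂)) ^ 2
          - 4 * s₂ * δ₂ * ((Real.exp t + h₂ t) * (Real.exp (s₂ * t) + h₂ (s₂ * t)))) t) :
    |δ₁ - δ₂| ≤ 2200000 * (1334 + 64 * (1 / (2 - σ))) * |s₁ - s₂| ∧
      ∀ t : ℝ, t ≤ 0 → |h₁ t - h₂ t| ≤ 2200000 * (1334 + 64 * (1 / (2 - σ))) * |s₁ - s₂| * Real.exp (t / 2) := by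
  -- constants
  have hσ2 : σ ≤ 2 := hσ.le
  have hs₁2 : s₁ ≤ 2 := hσ₁.trans hσ2
  have hs₂2 : s₂ ≤ 2 := hσ₂.trans hσ2
  have hs₁3 : (3 : ℝ) / 2 ≤ s₁ := by linarith only [hs₁]
  have hs₂3 : (3 : ℝ) / 2 ≤ s₂ := by linarith only [hs₂]
  have hs₁0 : 0 < s₁ := by linarith only [hs₁3]
  have hs₂0 : 0 < s₂ := by linarith only [hs₂3]
  set η : ℝ := max (2 - s₁) (2 - s₂) with hη
  have hη0 : 0 ≤ η := le_max_of_le_left (by linarith only [hs₁2])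
  have hη1 : η ≤ 1 / 10 ^ 26 := max_le (by linarith only [hs₁]) (by linarith only [hs₂])
  set rc : ℝ := 8800000 * η with hrc
  have hrc0 : 0 ≤ rc := by rw [hrc]; positivity
  have hr₁ : 8800000 * (2 - s₁) ≤ rc := mul_le_mul_of_nonneg_left (le_max_left _ _) (by norm_num)
  have hr₂ : 8800000 * (2 - s₂) ≤ rc := mul_le_mul_of_nonneg_left (le_max_right _ _) (by norm_num)
  have hrc4 : rc ≤ 4 := by rw [hrc]; nlinarith only [hη1, hη0]
  have hrc1 : rc ≤ 1 / 100 := by rw [hrc]; nlinarith only [hη1, hη0]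
  set κ : ℝ := 1100000 * (22 * η + 36 * rc + 32 * rc ^ 2) with hκ
  have hκ0 : 0 ≤ κ := by rw [hκ]; positivity
  have hκhalf : κ ≤ 1 / 2 := by rw [hκ, hrc]; exact contraction_ineq hη0 hη1
  have hκ₁ : 1100000 * (22 * |s₁ - 2| + 36 * rc + 32 * rc ^ 2) ≤ κ := by
    have : |s₁ - 2| ≤ η := by
      rw [abs_sub_comm, abs_of_nonneg (by linarith only [hs₁2])]; exact le_max_left _ _
    rw [hκ]; nlinarith only [this]
  have hq0 : 0 < 1 / (2 - σ) := one_div_pos.2 (by linarith only [hσ])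
  set L : ℝ := 1100000 * (1334 + 64 * (1 / (2 - σ))) * |s₁ - s₂| with hL
  have hL0 : 0 ≤ L := by rw [hL]; positivity
  -- the two fronts as states (radius `rc`)
  have hρ₁' : ∀ t : ℝ, t ≤ 0 → |h₁ t| ≤ rc * Real.exp (t / 2) := fun t ht =>
    (hρ₁ t ht).trans (mul_le_mul_of_nonneg_right hr₁ (Real.exp_pos _).le)
  have hρ₂' : ∀ t : ℝ, t ≤ 0 → |h₂ t| ≤ rc * Real.exp (t / 2) := fun t ht =>
    (hρ₂ t ht).trans (mul_le_mul_of_nonneg_right hr₂ (Real.exp_pos _).le)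
  obtain ⟨g₁, hgc₁, heq₁, hg0₁, hgl₁, hgρ₁, hgB₁, hgd₁⟩ := front_state hs₁0 hc₁ h0₁ hρ₁' hf₁
  obtain ⟨g₂, hgc₂, heq₂, hg0₂, hgl₂, hgρ₂, hgB₂, hgd₂⟩ := front_state hs₂0 hc₂ h0₂ hρ₂' hf₂
  have hgδ₁ : |δ₁| ≤ rc := hδ₁.trans hr₁
  have hgδ₂ : |δ₂| ≤ rc := hδ₂.trans hr₂
  suffices H : |δ₁ - δ₂| ≤ 2 * L ∧ ∀ t : ℝ, t ≤ 0 → |g₁ t - g₂ t| ≤ 2 * L * Real.exp (t / 2) by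
    have hL2 : 2 * L = 2200000 * (1334 + 64 * (1 / (2 - σ))) * |s₁ - s₂| := by rw [hL]; ring
    refine ⟨by rw [← hL2]; exact H.1, fun t ht => ?_⟩
    rw [← heq₁ t ht, ← heq₂ t ht, ← hL2]; exact H.2 t ht
  -- the derivative functions
  set F₁ : ℝ → ℝ := fun t => 2 * Real.exp (t / 2) * g₁ (t / 2) +
      (((-(Real.exp t - 4 / s₁ ^ 2 * Real.exp (2 * t / s₁)) -
          (2 * Real.exp (t / 2) * g₁ (t / 2) - 8 / s₁ ^ 2 * Real.exp (t / s₁) * g₁ (t / s₁)) +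
          4 / s₁ ^ 2 * g₁ (t / s₁) ^ 2 -
          δ₁ * (4 * s₁ * ((Real.exp t + g₁ t) * (Real.exp (s₁ * t) + g₁ (s₁ * t))) - 8 * Real.exp (3 * t))))
        - δ₁ * (8 * Real.exp (3 * t))) with hF₁
  set F₂ : ℝ → ℝ := fun t => 2 * Real.exp (t / 2) * g₂ (t / 2) +
      (((-(Real.exp t - 4 / s₂ ^ 2 * Real.exp (2 * t / s₂)) -
          (2 * Real.exp (t / 2) * g₂ (t / 2) - 8 / s₂ ^ 2 * Real.exp (t / s₂) * g₂ (t / s₂)) +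
          4 / s₂ ^ 2 * g₂ (t / s₂) ^ 2 -
          δ₂ * (4 * s₂ * ((Real.exp t + g₂ t) * (Real.exp (s₂ * t) + g₂ (s₂ * t))) - 8 * Real.exp (3 * t))))
        - δ₂ * (8 * Real.exp (3 * t))) with hF₂
  have hgd₁' : ∀ t : ℝ, t < 0 → HasDerivAt g₁ (F₁ t) t := fun t ht => hgd₁ t ht
  have hgd₂' : ∀ t : ℝ, t < 0 → HasDerivAt g₂ (F₂ t) t := fun t ht => hgd₂ t ht
  -- crude bounds: everything lies in the ball of radius `4`
  have hg4₁ : ∀ t : ℝ, t ≤ 0 → |g₁ t| ≤ 4 * Real.exp (t / 2) := fun t ht =>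
    (hgρ₁ t ht).trans (mul_le_mul_of_nonneg_right hrc4 (Real.exp_pos _).le)
  have hg4₂ : ∀ t : ℝ, t ≤ 0 → |g₂ t| ≤ 4 * Real.exp (t / 2) := fun t ht =>
    (hgρ₂ t ht).trans (mul_le_mul_of_nonneg_right hrc4 (Real.exp_pos _).le)
  have hδ4₂ : |δ₂| ≤ 4 := hgδ₂.trans hrc4
  have hF₁b : ∀ t : ℝ, t < 0 → |F₁ t| ≤ 4 * Real.exp (t / 2) := fun t ht =>
    bordered_rhs_crude hs₁3 hs₁2 hrc1 hgρ₁ hgδ₁ ht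
  have hF₂b : ∀ t : ℝ, t < 0 → |F₂ t| ≤ 4 * Real.exp (t / 2) := fun t ht =>
    bordered_rhs_crude hs₂3 hs₂2 hrc1 hgρ₂ hgδ₂ ht
  -- the comparison state
  obtain ⟨εy, gy, hgyc, hgy0, hgyl, ⟨By, hgyB⟩, hgyd, hDε, hDg, hDF⟩ :=
    comparison_state hs₁3 hσ₁ hs₂3 hσ₂ hσ hgc₂ hg0₂ hgl₂ hgB₂ hgd₂' (fun t => rfl) hg4₂ hF₂b hδ4₂
  -- iteration of the bounds
  have hIter : ∀ n : ℕ, (∀ t : ℝ, t ≤ 0 → |g₁ t - g₂ t| ≤ (8 * κ ^ n + 2 * L) * Real.exp (t / 2)) ∧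
      (∀ t : ℝ, t < 0 → |F₁ t - F₂ t| ≤ (8 * κ ^ n + 2 * L) * Real.exp (t / 2)) ∧
      |δ₁ - δ₂| ≤ 8 * κ ^ n + 2 * L := by
    intro n
    induction n with
    | zero =>
      rw [pow_zero, mul_one]
      refine ⟨fun t ht => ?_, fun t ht => ?_, ?_⟩
      · have e0 := Real.exp_pos (t / 2)
        calc |g₁ t - g₂ t| ≤ |g₁ t| + |g₂ t| := abs_sub _ _
          _ ≤ 4 * Real.exp (t / 2) + 4 * Real.exp (t / 2) := add_le_add (hg4₁ t ht) (hg4₂ t ht)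
          _ ≤ (8 + 2 * L) * Real.exp (t / 2) := by nlinarith only [e0, hL0]
      · have e0 := Real.exp_pos (t / 2)
        calc |F₁ t - F₂ t| ≤ |F₁ t| + |F₂ t| := abs_sub _ _
          _ ≤ 4 * Real.exp (t / 2) + 4 * Real.exp (t / 2) := add_le_add (hF₁b t ht) (hF₂b t ht)
          _ ≤ (8 + 2 * L) * Real.exp (t / 2) := by nlinarith only [e0, hL0]
      · calc |δ₁ - δ₂| ≤ |δ₁| + |δ₂| := abs_sub _ _
          _ ≤ 4 + 4 := add_le_add (hgδ₁.trans hrc4) hδ4₂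
          _ ≤ 8 + 2 * L := by linarith only [hL0]
    | succ n ih =>
      obtain ⟨ih1, ih2, ih3⟩ := ih
      obtain ⟨hS1, hS2, hS3⟩ := branch_step (μ := 8 * κ ^ n + 2 * L) (L := L) hs₁3 hs₁2 hgc₁ hgc₂ hgyc
        hgd₁' hgd₂' (fun t => rfl) hgρ₁ hgρ₂ hgδ₁ hg0₁ hgy0 hgl₁ hgyl hgB₁ hgyB hgyd
        (by rw [hL]; exact hDε) (fun t ht => by rw [hL]; exact hDg t ht) (fun t ht => by rw [hL]; exact hDF t ht)
        ih1 ih2 ih3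
      have hμ0 : 0 ≤ 8 * κ ^ n + 2 * L := by positivity
      have hK : 1100000 * (22 * |s₁ - 2| + 36 * rc + 32 * rc ^ 2) * (8 * κ ^ n + 2 * L) + L ≤
          8 * κ ^ (n + 1) + 2 * L := by
        have h1 := mul_le_mul_of_nonneg_right hκ₁ hμ0
        have h2 : κ * (8 * κ ^ n + 2 * L) + L ≤ 8 * κ ^ (n + 1) + 2 * L := by
          rw [pow_succ]
          nlinarith only [mul_nonneg hκ0 hL0, hκhalf, hL0]
        linarith only [h1, h2]
      exact ⟨fun t ht => (hS1 t ht).trans (mul_le_mul_of_nonneg_right hK (Real.exp_pos _).le),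
        fun t ht => (hS2 t ht).trans (mul_le_mul_of_nonneg_right hK (Real.exp_pos _).le), hS3.trans hK⟩
  -- pass to the limit `n → ∞`
  have hgeo : Tendsto (fun n : ℕ => 8 * κ ^ n + 2 * L) atTop (𝓝 (2 * L)) := by
    have := ((tendsto_pow_atTop_nhds_zero_of_lt_one hκ0 (by linarith only [hκhalf])).const_mul 8).add_const
      (2 * L)
    rwa [mul_zero, zero_add] at this
  refine ⟨ge_of_tendsto' hgeo fun n => (hIter n).2.2, fun t ht => ?_⟩
  have hgeo' : Tendsto (fun n : ℕ => (8 * κ ^ n + 2 * L) * Real.exp (t / 2)) atTop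
      (𝓝 (2 * L * Real.exp (t / 2))) := hgeo.mul_const _
  exact ge_of_tendsto' hgeo' fun n => (hIter n).1 t ht

end WakeRatchetRelayBranch

end Summit.NavierStokesRegularity.NavierStokesRegularity.Theorems

end
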